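import Summits.Ventures.PercRepro.LineLadderBridge

/-!
# PercRepro — the generic Pascal step on abstract orbit profiles (p9, gen 13)

`proofs/P9-S4-LINELADDER-g13.md` §6, in the abstract: a finite set of orbit profiles `(k₁ X, k₂ X)` (for a block `B`:
`X ⊆ B.E`, `k₁ X = ρ_B X`, `k₂ X = ρ_B(B.E ∖ X)`), the `U`- and `Y`-sums of `T_p(B ⊕ U_{m,m})` written as double sums
over the profiles and the sizes `a` of the generic part, and THE GENERIC STEP `profiles_ineq_of_base`: on every layer
`m ≥ m₀` on which all profiles are active, `Φ(p, q)·U ≤ Y` follows from the base-layer inequalities at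
`(p − j, q − j, m₀)`, `j ≤ q`, by Pascal's rule (`orbit_U_succ`, `orbit_Y_succ`) and Lemma E (`phiK_succ_succ_le`).
The matroid side is `BlockSum.lean`.
-/

namespace PercRepro.LineLadder

open Set Finset

/-! ### The generic Pascal step on abstract orbit profiles (P9-S4-LINELADDER-g13.md §6) -/

/-- The `U`-summand of one orbit: when the orbit is active (`k₁ + k₂ + m ≥ p + q`) and `q < p`, exactly the
`a` with `m − a = q − k₂` survives (none if `k₂ > q`). -/
lemma orbit_sum_U (p q m k₁ k₂ : ℕ) (hqp : q < p) (hact : p + q ≤ k₁ + k₂ + m) :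
    ∑ a ∈ range (m + 1), (if min p (k₁ + a) = p ∧ min p (k₂ + (m - a)) = q then m.choose a else 0)
      = if k₂ ≤ q then m.choose (q - k₂) else 0 := by
  by_cases hk : k₂ ≤ q
  · rw [if_pos hk]
    by_cases hqm : q - k₂ ≤ m
    · rw [← Nat.choose_symm hqm, ← sum_range_ite_eq_single m k₂ q hqm (fun a => m.choose a)]
      refine Finset.sum_congr rfl fun a ha => ?_
      rw [Finset.mem_range] at ha
      have : (min p (k₁ + a) = p ∧ min p (k₂ + (m - a)) = q) ↔ m - a = q - k₂ := by
        constructor <;> intro h <;> omega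
      rw [if_congr this rfl rfl]
    · rw [Nat.choose_eq_zero_of_lt (by omega)]
      refine Finset.sum_eq_zero fun a ha => ?_
      rw [Finset.mem_range] at ha
      rw [if_neg]; omega
  · rw [if_neg hk]
    refine Finset.sum_eq_zero fun a ha => ?_
    rw [if_neg]; omega

/-- The `Y`-summand of one orbit is a partial row sum (`sum_range_ite_Ico`). -/
lemma orbit_sum_Y (p q m k₁ : ℕ) :
    ∑ a ∈ range (m + 1), (if q < min p (k₁ + a) ∧ min p (k₁ + a) < p then m.choose a else 0)
      = ∑ a ∈ Ico (q + 1 - k₁) (p - k₁), m.choose a :=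
  sum_range_ite_Ico m k₁ p q

/-- **Pascal for the `U`-orbit sum**: active at `(p, q, m)`, `1 ≤ q < p`:
`u(p, q, m+1) = u(p, q, m) + u(p−1, q−1, m)`. -/
lemma orbit_U_succ (p q m k₁ k₂ : ℕ) (hq : 1 ≤ q) (hqp : q < p) (hact : p + q ≤ k₁ + k₂ + m) :
    ∑ a ∈ range (m + 1 + 1), (if min p (k₁ + a) = p ∧ min p (k₂ + (m + 1 - a)) = q then (m + 1).choose a else 0)
      = ∑ a ∈ range (m + 1), (if min p (k₁ + a) = p ∧ min p (k₂ + (m - a)) = q then m.choose a else 0)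
        + ∑ a ∈ range (m + 1), (if min (p - 1) (k₁ + a) = p - 1 ∧ min (p - 1) (k₂ + (m - a)) = q - 1
            then m.choose a else 0) := by
  rw [orbit_sum_U p q (m + 1) k₁ k₂ hqp (by omega), orbit_sum_U p q m k₁ k₂ hqp hact,
    orbit_sum_U (p - 1) (q - 1) m k₁ k₂ (by omega) (by omega)]
  by_cases hk : k₂ ≤ q
  · rw [if_pos hk]
    by_cases hk' : k₂ ≤ q - 1
    · rw [if_pos hk', if_pos hk, show q - k₂ = (q - 1 - k₂) + 1 by omega, Nat.choose_succ_succ']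
      ring
    · rw [if_neg hk', if_pos hk, show q - k₂ = 0 by omega]
      simp
  · rw [if_neg hk, if_neg hk, if_neg (by omega)]

/-- **Pascal for the `Y`-orbit sum**: `1 ≤ q`, `q + 1 < p`: `y(p, q, m+1) = y(p, q, m) + y(p−1, q−1, m)`. -/
lemma orbit_Y_succ (p q m k₁ : ℕ) (hq : 1 ≤ q) (hqp : q + 1 < p) :
    ∑ a ∈ range (m + 1 + 1), (if q < min p (k₁ + a) ∧ min p (k₁ + a) < p then (m + 1).choose a else 0)
      = ∑ a ∈ range (m + 1), (if q < min p (k₁ + a) ∧ min p (k₁ + a) < p then m.choose a else 0)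
        + ∑ a ∈ range (m + 1), (if q - 1 < min (p - 1) (k₁ + a) ∧ min (p - 1) (k₁ + a) < p - 1
            then m.choose a else 0) := by
  rw [orbit_sum_Y, orbit_sum_Y, orbit_sum_Y]
  by_cases hk : k₁ ≤ q
  · rw [sum_choose_succ' m (q + 1 - k₁) (p - k₁) (by omega), show q + 1 - k₁ - 1 = q - 1 + 1 - k₁ by omega,
      show p - k₁ - 1 = p - 1 - k₁ by omega]
  · rw [show q + 1 - k₁ = 0 by omega, show q - 1 + 1 - k₁ = 0 by omega]
    by_cases hp : p - k₁ = 0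
    · rw [hp, show p - 1 - k₁ = 0 by omega]; simp
    · rw [sum_choose_succ_zero' m (p - k₁) (by omega), show p - k₁ - 1 = p - 1 - k₁ by omega]

/-- Pascal for the full `U`-sum over a finite set of orbit profiles (active at `(p, q, m)`, `1 ≤ q < p`). -/
lemma profiles_U_succ {ι : Type*} (𝒳 : Finset ι) (k₁ k₂ : ι → ℕ) (p q m : ℕ) (hq : 1 ≤ q) (hqp : q < p)
    (hact : ∀ X ∈ 𝒳, p + q ≤ k₁ X + k₂ X + m) :
    ∑ X ∈ 𝒳, ∑ a ∈ range (m + 1 + 1),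
        (if min p (k₁ X + a) = p ∧ min p (k₂ X + (m + 1 - a)) = q then (m + 1).choose a else 0)
      = ∑ X ∈ 𝒳, ∑ a ∈ range (m + 1),
          (if min p (k₁ X + a) = p ∧ min p (k₂ X + (m - a)) = q then m.choose a else 0)
        + ∑ X ∈ 𝒳, ∑ a ∈ range (m + 1),
          (if min (p - 1) (k₁ X + a) = p - 1 ∧ min (p - 1) (k₂ X + (m - a)) = q - 1 then m.choose a else 0) := by
  rw [← Finset.sum_add_distrib]
  exact Finset.sum_congr rfl fun X hX => orbit_U_succ p q m (k₁ X) (k₂ X) hq hqp (hact X hX)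

/-- Pascal for the full `Y`-sum over a finite set of orbit profiles (`1 ≤ q`, `q + 1 < p`). -/
lemma profiles_Y_succ {ι : Type*} (𝒳 : Finset ι) (k₁ : ι → ℕ) (p q m : ℕ) (hq : 1 ≤ q) (hqp : q + 1 < p) :
    ∑ X ∈ 𝒳, ∑ a ∈ range (m + 1 + 1),
        (if q < min p (k₁ X + a) ∧ min p (k₁ X + a) < p then (m + 1).choose a else 0)
      = ∑ X ∈ 𝒳, ∑ a ∈ range (m + 1), (if q < min p (k₁ X + a) ∧ min p (k₁ X + a) < p then m.choose a else 0)
        + ∑ X ∈ 𝒳, ∑ a ∈ range (m + 1),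
          (if q - 1 < min (p - 1) (k₁ X + a) ∧ min (p - 1) (k₁ X + a) < p - 1 then m.choose a else 0) := by
  rw [← Finset.sum_add_distrib]
  exact Finset.sum_congr rfl fun X _ => orbit_Y_succ p q m (k₁ X) hq hqp

/-- At level `q = 0` the `U`-sum is constant on the active layers. -/
lemma profiles_U_zero_succ {ι : Type*} (𝒳 : Finset ι) (k₁ k₂ : ι → ℕ) (p m : ℕ) (hp : 1 ≤ p)
    (hact : ∀ X ∈ 𝒳, p ≤ k₁ X + k₂ X + m) :
    ∑ X ∈ 𝒳, ∑ a ∈ range (m + 1 + 1),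
        (if min p (k₁ X + a) = p ∧ min p (k₂ X + (m + 1 - a)) = 0 then (m + 1).choose a else 0)
      = ∑ X ∈ 𝒳, ∑ a ∈ range (m + 1),
          (if min p (k₁ X + a) = p ∧ min p (k₂ X + (m - a)) = 0 then m.choose a else 0) := by
  refine Finset.sum_congr rfl fun X hX => ?_
  rw [orbit_sum_U p 0 (m + 1) (k₁ X) (k₂ X) hp (by have := hact X hX; omega),
    orbit_sum_U p 0 m (k₁ X) (k₂ X) hp (by have := hact X hX; omega)]
  by_cases hk : k₂ X ≤ 0
  · rw [if_pos hk, if_pos hk, Nat.zero_sub, Nat.choose_zero_right, Nat.choose_zero_right]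
  · rw [if_neg hk, if_neg hk]

/-- The `Y`-sum is nondecreasing in `m`. -/
lemma profiles_Y_mono {ι : Type*} (𝒳 : Finset ι) (k₁ : ι → ℕ) (p q m : ℕ) :
    ∑ X ∈ 𝒳, ∑ a ∈ range (m + 1), (if q < min p (k₁ X + a) ∧ min p (k₁ X + a) < p then m.choose a else 0)
      ≤ ∑ X ∈ 𝒳, ∑ a ∈ range (m + 1 + 1),
          (if q < min p (k₁ X + a) ∧ min p (k₁ X + a) < p then (m + 1).choose a else 0) := by
  refine Finset.sum_le_sum fun X _ => ?_
  rw [orbit_sum_Y, orbit_sum_Y]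
  exact Finset.sum_le_sum fun a _ => Nat.choose_le_succ m a

/-- **THE GENERIC STEP (P9-S4-LINELADDER-g13.md §6)**: for any finite set of orbit profiles `(k₁ X, k₂ X)` and any base
layer `m₀` on which every profile is active, the inequality `Φ(p, q)·U ≤ Y` at `(p, q, m)` for every `m ≥ m₀` follows
from the base-layer inequalities at `(p − j, q − j, m₀)`, `j ≤ q`, by Pascal's rule and Lemma E. -/
theorem profiles_ineq_of_base {ι : Type*} (𝒳 : Finset ι) (k₁ k₂ : ι → ℕ) :
    ∀ (q p m₀ : ℕ), q + 2 ≤ p → (∀ X ∈ 𝒳, p + q ≤ k₁ X + k₂ X + m₀) →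
      (∀ j ≤ q, phiK (p - j) (q - j) *
          ((∑ X ∈ 𝒳, ∑ a ∈ range (m₀ + 1),
            (if min (p - j) (k₁ X + a) = p - j ∧ min (p - j) (k₂ X + (m₀ - a)) = q - j then m₀.choose a else 0) : ℕ) : ℚ)
        ≤ ((∑ X ∈ 𝒳, ∑ a ∈ range (m₀ + 1),
            (if q - j < min (p - j) (k₁ X + a) ∧ min (p - j) (k₁ X + a) < p - j then m₀.choose a else 0) : ℕ) : ℚ)) →
      ∀ m, m₀ ≤ m →
        phiK p q * ((∑ X ∈ 𝒳, ∑ a ∈ range (m + 1),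
            (if min p (k₁ X + a) = p ∧ min p (k₂ X + (m - a)) = q then m.choose a else 0) : ℕ) : ℚ)
          ≤ ((∑ X ∈ 𝒳, ∑ a ∈ range (m + 1),
            (if q < min p (k₁ X + a) ∧ min p (k₁ X + a) < p then m.choose a else 0) : ℕ) : ℚ) := by
  intro q
  induction q with
  | zero =>
    intro p m₀ hpq hact hbase m hm
    have h0 := hbase 0 (le_refl 0)
    simp only [Nat.sub_zero] at h0
    refine Nat.le_induction h0 (fun m' hm' ih => ?_) m hm
    rw [profiles_U_zero_succ 𝒳 k₁ k₂ p m' (by omega) (fun X hX => by have := hact X hX; omega)]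
    refine ih.trans ?_
    exact_mod_cast profiles_Y_mono 𝒳 k₁ p 0 m'
  | succ q ih =>
    intro p m₀ hpq hact hbase m hm
    have h0 := hbase 0 (Nat.zero_le _)
    simp only [Nat.sub_zero] at h0
    refine Nat.le_induction h0 (fun m' hm' ih' => ?_) m hm
    have hlow := ih (p - 1) m₀ (by omega) (fun X hX => by have := hact X hX; omega)
      (fun j hj => by
        have := hbase (j + 1) (by omega)
        simpa [show p - (j + 1) = p - 1 - j by omega, show q + 1 - (j + 1) = q - j by omega] using this)
      m' hm'
    have hE : phiK p (q + 1) ≤ phiK (p - 1) q := by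
      have := phiK_succ_succ_le (p - 1) q
      rwa [show p - 1 + 1 = p by omega] at this
    rw [profiles_U_succ 𝒳 k₁ k₂ p (q + 1) m' (by omega) (by omega)
        (fun X hX => by have := hact X hX; omega),
      profiles_Y_succ 𝒳 k₁ p (q + 1) m' (by omega) (by omega)]
    simp only [Nat.add_sub_cancel] at hlow ⊢
    have hnn : (0 : ℚ) ≤ ((∑ X ∈ 𝒳, ∑ a ∈ range (m' + 1),
        (if min (p - 1) (k₁ X + a) = p - 1 ∧ min (p - 1) (k₂ X + (m' - a)) = q then m'.choose a else 0) : ℕ) : ℚ) := by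
      positivity
    have hmul := mul_le_mul_of_nonneg_right hE hnn
    push_cast at ih' hlow hmul ⊢
    nlinarith [ih', hlow, hmul]


end PercRepro.LineLadder
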